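import Summits.NavierStokesRegularity.NavierStokesRegularity.Theorems.ScaledTopAlignmentFlexibleZoom
import Summits.NavierStokesRegularity.NavierStokesRegularity.Theorems.ScaledTopAlignmentTypeIProfileUniformBudgetDecoherence
import HarnessLib

/-!
# Route `ScaledTopAlignment`, crux W3ᵐᵗ = `AprioriMostTimesBulkAlignment` (stmt-NavierStokesRegularity-19551),
# registered line `nearmax` (`Cruxes/AprioriMostTimesBulkAlignment/Lines/nearmax.lean`, open stub
# `stub_nearMaxMostTimes`): the Type-I zoom at CALLER-CHOSEN space–time points, read on the VORTICITY and
# its gradient, and the exact scaling of the near-max window functionals (direction budget / saturation)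

The tree's Type-I zooms (`typeIZoom_ancientMild_limit_flexible`, `ScaledTopAlignmentFlexibleZoom`) let the
caller choose the base TIMES `τ_j → T` but place the centres at Leray near-maximum points of the velocity
(for non-triviality of the limit). The glue of the BUDGET-currency laws of the cell planner (nsreg-p3,
ROUND-10 `Law10-rev2.lean`: law UDW∞ `UniversalNearMaxWindowCoherenceLaw`, glue stubs G1
`stub_alignedProfile_of_lawM` / S2 `stub_exactKill`) reads the flow at points it selects ITSELF (rate points
whose near-max window has a small direction budget), so it needs the zoom centred at caller-chosen points
`(τ_j, x_j)`; non-triviality then comes from the caller's rate floor `κ/(T − τ_j) ≤ |ω(τ_j, x_j)|`, not from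
Leray's rate. This module supplies:

* `typeIZoom_vorticity_at_points` — for ν > 0, a classical Leray–Hopf solution on `[0,T)` bounded on closed
  sub-strips with the Type-I rate at `T`, ANY base points `(τ_j, x_j)`, `τ_j ∈ [0,T)`, `τ_j → T`: along a
  subsequence `φ` there are `C`, `W ∈ IsTypeIAncientMild C` and scales `λ_j > 0`, `λ_j² = ν(T − τ_{φ j})`,
  such that for every `s < 0` the rescaled vorticities `(λ_j²/ν) ω(T + λ_j² s/ν, x_{φ j} + λ_j y)` converge to
  `curl W(s)` LOCALLY UNIFORMLY in `y` and their spatial derivatives converge pointwise to `D(curl W(s))`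
  (KNSS 2009 §6 rescaling + the tree's `C²_loc` window compactness `exists_tendsto_of_typeI_oseenMild_windows`;
  the slice `s = −1` reads the solution at the caller's times exactly);
* the exact scaling of the window functionals of the BUDGET currency under the zoom `y ↦ x + λ y`, amplitude
  `a = λ²/ν`: the direction field is pulled back (`vorticityDirection_zoom`), its derivative scales by `λ`
  (`fderiv_vorticityDirection_zoom`), the near-max parabolic window `{λ₀|ω(x)| ≤ |ω|, |· − x| ≤ R₀√(ν/|ω(x)|)}`
  is the image of the unit-viscosity window `{λ₀|ω̃(0)| ≤ |ω̃|, |·| ≤ R₀/√|ω̃(0)|}` (`preimage_window_zoom`), and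
  the direction budget `∫|ω|^{3/2}‖∇ξ‖²` and the saturation `∫|ω|^{5/2}/ν` acquire the SAME factor
  (`setLIntegral_budget_zoom`, `setLIntegral_sat_zoom`, `zoom_factor_eq`), so that a window whose budget is
  at most `δ` times its saturation zooms to a window with the same property (`budget_le_sat_zoom`).

WHAT THIS IS NOT: not NS regularity and not a proof of the stub; compactness and calculus about hypothetical
Type-I blow-ups (the residual hard core NoTypeII says these are the only first blow-ups). [folklore]

## References
* G. Koch, N. Nadirashvili, G. Seregin, V. Šverák, Acta Math. 203 (2009) 83–105 = arXiv:0709.3599: §4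
  Prop. 4.1 (p. 8), §6 Lemma 6.1 and proof of Thm 6.2 (pp. 11–13). [KochNadirashviliSereginSverak2009]
* Y. Giga, H. Miura, Comm. Math. Phys. 303 (2011) 289–300, §2.1 (the blow-up sequence). [GigaMiura2011]
-/

noncomputable section

-- the summit and its single sub-problem share the name (CONVENTIONS §1), as in every Theorems file
set_option linter.dupNamespace false

open MeasureTheory Set Function Filter Topology Metric
open scoped RealInnerProductSpace ENNReal NNReal

namespace Summit.NavierStokesRegularity.NavierStokesRegularity.Theorems

open Literature.Analysis Literature.Analysis.FluidPDE

/-! ### Scaling of the direction field and of the window functionals under the zoom -/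

section Scaling

variable {ω : EuclideanSpace ℝ (Fin 3) → EuclideanSpace ℝ (Fin 3)} {x : EuclideanSpace ℝ (Fin 3)}
  {a lam : ℝ}

/-- The direction field of the zoomed field `y ↦ a ω(x + λ y)`, `a > 0`, is the pulled-back direction
field `ξ(x + λ y)`. [folklore] -/
theorem vorticityDirection_zoom (ha : 0 < a) (x : EuclideanSpace ℝ (Fin 3)) (lam : ℝ) :
    vorticityDirection (fun y => a • ω (x + lam • y)) = fun y => vorticityDirection ω (x + lam • y) := by
  funext y
  rw [vorticityDirection_const_smul (ω := fun y => ω (x + lam • y)) ha y, vorticityDirection_apply,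
    vorticityDirection_apply]

/-- The derivative of the zoomed direction field: `D(ξ(x + λ ·))(y) = λ • (Dξ)(x + λ y)` (chain rule through
the affine map; no differentiability hypothesis, as in the tree's `fderiv_stPull`). [folklore] -/
theorem fderiv_vorticityDirection_zoom (ha : 0 < a) (x y : EuclideanSpace ℝ (Fin 3)) (lam : ℝ) :
    fderiv ℝ (vorticityDirection (fun y => a • ω (x + lam • y))) y =
      lam • fderiv ℝ (vorticityDirection ω) (x + lam • y) := by
  rw [vorticityDirection_zoom ha]
  have h := fderiv_comp_smul (𝕜 := ℝ) (f := fun z => vorticityDirection ω (x + z)) (x := y) lam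
  rw [fderiv_comp_add_left] at h
  exact h

/-- **The near-max parabolic window zooms to the unit-viscosity window.** For `λ > 0`, `ν > 0`,
`a = λ²/ν` and `ω(x) ≠ 0`, the preimage under `y ↦ x + λ y` of the flow window
`{z | λ₀|ω(x)| ≤ |ω(z)|, |z − x| ≤ R₀ √(ν/|ω(x)|)}` is the window
`{y | λ₀|ω̃(0)| ≤ |ω̃(y)|, |y − 0| ≤ R₀/√|ω̃(0)|}` of the zoomed field `ω̃(y) = a ω(x + λ y)`. [folklore] -/
theorem preimage_window_zoom {ν : ℝ} (hν : 0 < ν) (hlam : 0 < lam) (ha : a = lam ^ 2 / ν)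
    (hx : ω x ≠ 0) (lam0 R0 : ℝ) :
    (fun y => x + lam • y) ⁻¹'
        {z : EuclideanSpace ℝ (Fin 3) | lam0 * ‖ω x‖ ≤ ‖ω z‖ ∧ ‖z - x‖ ≤ R0 * Real.sqrt (ν / ‖ω x‖)} =
      {y : EuclideanSpace ℝ (Fin 3) | lam0 * ‖(fun y => a • ω (x + lam • y)) 0‖ ≤
          ‖(fun y => a • ω (x + lam • y)) y‖ ∧
        ‖y - 0‖ ≤ R0 / Real.sqrt ‖(fun y => a • ω (x + lam • y)) 0‖} := by
  have hapos : 0 < a := by rw [ha]; positivity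
  have hp : 0 < ‖ω x‖ := norm_pos_iff.2 hx
  ext y
  simp only [mem_preimage, mem_setOf_eq, smul_zero, add_zero, sub_zero, add_sub_cancel_left, norm_smul,
    Real.norm_of_nonneg hapos.le, Real.norm_of_nonneg hlam.le]
  have h1 : lam0 * ‖ω x‖ ≤ ‖ω (x + lam • y)‖ ↔ lam0 * (a * ‖ω x‖) ≤ a * ‖ω (x + lam • y)‖ := by
    rw [show lam0 * (a * ‖ω x‖) = a * (lam0 * ‖ω x‖) by ring]
    exact ⟨fun h => mul_le_mul_of_nonneg_left h hapos.le, fun h => le_of_mul_le_mul_left h hapos⟩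
  have hsa : Real.sqrt (a * ‖ω x‖) = lam * Real.sqrt ‖ω x‖ / Real.sqrt ν := by
    rw [ha, show lam ^ 2 / ν * ‖ω x‖ = lam ^ 2 * (‖ω x‖ / ν) by ring,
      Real.sqrt_mul (sq_nonneg _), Real.sqrt_sq hlam.le, Real.sqrt_div (norm_nonneg _)]
    ring
  have hsν : 0 < Real.sqrt ν := Real.sqrt_pos.2 hν
  have hsp : 0 < Real.sqrt ‖ω x‖ := Real.sqrt_pos.2 hp
  have hsp0 : Real.sqrt ‖ω x‖ ≠ 0 := hsp.ne'
  have h2 : lam * ‖y‖ ≤ R0 * Real.sqrt (ν / ‖ω x‖) ↔ ‖y‖ ≤ R0 / Real.sqrt (a * ‖ω x‖) := by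
    rw [hsa, Real.sqrt_div hν.le, div_div_eq_mul_div, le_div_iff₀ (mul_pos hlam hsp)]
    constructor
    · intro h
      have := mul_le_mul_of_nonneg_right h hsp.le
      calc ‖y‖ * (lam * Real.sqrt ‖ω x‖) = lam * ‖y‖ * Real.sqrt ‖ω x‖ := by ring
        _ ≤ R0 * (Real.sqrt ν / Real.sqrt ‖ω x‖) * Real.sqrt ‖ω x‖ := this
        _ = R0 * Real.sqrt ν := by field_simp
    · intro h
      have := div_le_div_of_nonneg_right h hsp.le
      calc lam * ‖y‖ = ‖y‖ * (lam * Real.sqrt ‖ω x‖) / Real.sqrt ‖ω x‖ := by field_simp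
        _ ≤ R0 * Real.sqrt ν / Real.sqrt ‖ω x‖ := this
        _ = R0 * (Real.sqrt ν / Real.sqrt ‖ω x‖) := by ring
  rw [h1, h2]

/-- Substitution in window integrals: `∫_{Φ⁻¹ S} G(Φ y) dy = λ⁻³ ∫_S G` for `Φ(y) = x + λ y`, `λ > 0`, `S`
measurable (`ℝ³`; the tree's `PoincareBall.lintegral_comp_smul_add`). [folklore] -/
theorem setLIntegral_preimage_zoom (G : EuclideanSpace ℝ (Fin 3) → ℝ≥0∞) (hlam : 0 < lam)
    (x : EuclideanSpace ℝ (Fin 3)) {S : Set (EuclideanSpace ℝ (Fin 3))} (hS : MeasurableSet S) :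
    ∫⁻ y in (fun y => x + lam • y) ⁻¹' S, G (x + lam • y) =
      ENNReal.ofReal (lam ^ 3)⁻¹ * ∫⁻ z in S, G z := by
  have hΦ : Measurable fun y : EuclideanSpace ℝ (Fin 3) => x + lam • y := by fun_prop
  rw [← lintegral_indicator (hΦ hS), ← lintegral_indicator hS]
  have e : (fun y => ((fun y => x + lam • y) ⁻¹' S).indicator (fun y => G (x + lam • y)) y) =
      fun y => S.indicator G (lam • y + x) := by
    funext y
    rw [show (fun y => G (x + lam • y)) = G ∘ (fun y => x + lam • y) from rfl, indicator_comp_right,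
      add_comm]
  rw [e, PoincareBall.lintegral_comp_smul_add (S.indicator G) hlam.ne' x, finrank_euclideanSpace_fin,
    abs_of_nonneg (inv_nonneg.2 (pow_nonneg hlam.le 3))]

/-- **The direction budget under the zoom.** For `a, λ > 0`, `ω̃(y) = a ω(x + λ y)` and a measurable `S`:
`∫_{Φ⁻¹ S} |ω̃|^{3/2} ‖Dξ̃‖² = (a^{3/2} λ² λ⁻³) ∫_S |ω|^{3/2} ‖Dξ‖²`. [folklore] -/
theorem setLIntegral_budget_zoom (ha : 0 < a) (hlam : 0 < lam) (x : EuclideanSpace ℝ (Fin 3))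
    {S : Set (EuclideanSpace ℝ (Fin 3))} (hS : MeasurableSet S) :
    ∫⁻ y in (fun y => x + lam • y) ⁻¹' S,
        ENNReal.ofReal (‖(fun y => a • ω (x + lam • y)) y‖ ^ (3 / 2 : ℝ) *
          ‖fderiv ℝ (vorticityDirection (fun y => a • ω (x + lam • y))) y‖ ^ 2) =
      ENNReal.ofReal (a ^ (3 / 2 : ℝ) * lam ^ 2 * (lam ^ 3)⁻¹) *
        ∫⁻ z in S, ENNReal.ofReal (‖ω z‖ ^ (3 / 2 : ℝ) * ‖fderiv ℝ (vorticityDirection ω) z‖ ^ 2) := by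
  set G : EuclideanSpace ℝ (Fin 3) → ℝ≥0∞ := fun z =>
    ENNReal.ofReal (‖ω z‖ ^ (3 / 2 : ℝ) * ‖fderiv ℝ (vorticityDirection ω) z‖ ^ 2) with hG
  have e : ∀ y, ENNReal.ofReal (‖(fun y => a • ω (x + lam • y)) y‖ ^ (3 / 2 : ℝ) *
      ‖fderiv ℝ (vorticityDirection (fun y => a • ω (x + lam • y))) y‖ ^ 2) =
      ENNReal.ofReal (a ^ (3 / 2 : ℝ) * lam ^ 2) * G (x + lam • y) := by
    intro y
    rw [hG]
    simp only []
    rw [fderiv_vorticityDirection_zoom ha, norm_smul, norm_smul, Real.norm_of_nonneg ha.le,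
      Real.norm_of_nonneg hlam.le, Real.mul_rpow ha.le (norm_nonneg _), mul_pow,
      ← ENNReal.ofReal_mul (by positivity)]
    congr 1
    ring
  calc ∫⁻ y in (fun y => x + lam • y) ⁻¹' S,
        ENNReal.ofReal (‖(fun y => a • ω (x + lam • y)) y‖ ^ (3 / 2 : ℝ) *
          ‖fderiv ℝ (vorticityDirection (fun y => a • ω (x + lam • y))) y‖ ^ 2)
      = ∫⁻ y in (fun y => x + lam • y) ⁻¹' S, ENNReal.ofReal (a ^ (3 / 2 : ℝ) * lam ^ 2) * G (x + lam • y) :=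
        lintegral_congr e
    _ = ENNReal.ofReal (a ^ (3 / 2 : ℝ) * lam ^ 2) * ∫⁻ y in (fun y => x + lam • y) ⁻¹' S, G (x + lam • y) :=
        lintegral_const_mul' _ _ ENNReal.ofReal_ne_top
    _ = ENNReal.ofReal (a ^ (3 / 2 : ℝ) * lam ^ 2) * (ENNReal.ofReal (lam ^ 3)⁻¹ * ∫⁻ z in S, G z) := by
        rw [setLIntegral_preimage_zoom G hlam x hS]
    _ = ENNReal.ofReal (a ^ (3 / 2 : ℝ) * lam ^ 2 * (lam ^ 3)⁻¹) * ∫⁻ z in S, G z := by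
        rw [← mul_assoc, ← ENNReal.ofReal_mul (by positivity)]

/-- **The saturation under the zoom.** For `a, λ, ν > 0`, `ω̃(y) = a ω(x + λ y)` and a measurable `S`:
`∫_{Φ⁻¹ S} |ω̃|^{5/2} = (a^{5/2} λ⁻³ ν) ∫_S |ω|^{5/2}/ν`. [folklore] -/
theorem setLIntegral_sat_zoom {ν : ℝ} (hν : 0 < ν) (ha : 0 < a) (hlam : 0 < lam)
    (x : EuclideanSpace ℝ (Fin 3)) {S : Set (EuclideanSpace ℝ (Fin 3))} (hS : MeasurableSet S) :
    ∫⁻ y in (fun y => x + lam • y) ⁻¹' S, ENNReal.ofReal (‖(fun y => a • ω (x + lam • y)) y‖ ^ (5 / 2 : ℝ)) =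
      ENNReal.ofReal (a ^ (5 / 2 : ℝ) * (lam ^ 3)⁻¹ * ν) *
        ∫⁻ z in S, ENNReal.ofReal (‖ω z‖ ^ (5 / 2 : ℝ) / ν) := by
  have hν0 : ν ≠ 0 := hν.ne'
  set G : EuclideanSpace ℝ (Fin 3) → ℝ≥0∞ := fun z => ENNReal.ofReal (‖ω z‖ ^ (5 / 2 : ℝ) / ν) with hG
  have e : ∀ y, ENNReal.ofReal (‖(fun y => a • ω (x + lam • y)) y‖ ^ (5 / 2 : ℝ)) =
      ENNReal.ofReal (a ^ (5 / 2 : ℝ) * ν) * G (x + lam • y) := by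
    intro y
    rw [hG]
    simp only []
    rw [norm_smul, Real.norm_of_nonneg ha.le, Real.mul_rpow ha.le (norm_nonneg _),
      ← ENNReal.ofReal_mul (by positivity)]
    congr 1
    field_simp
  calc ∫⁻ y in (fun y => x + lam • y) ⁻¹' S, ENNReal.ofReal (‖(fun y => a • ω (x + lam • y)) y‖ ^ (5 / 2 : ℝ))
      = ∫⁻ y in (fun y => x + lam • y) ⁻¹' S, ENNReal.ofReal (a ^ (5 / 2 : ℝ) * ν) * G (x + lam • y) :=
        lintegral_congr e
    _ = ENNReal.ofReal (a ^ (5 / 2 : ℝ) * ν) * ∫⁻ y in (fun y => x + lam • y) ⁻¹' S, G (x + lam • y) :=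
        lintegral_const_mul' _ _ ENNReal.ofReal_ne_top
    _ = ENNReal.ofReal (a ^ (5 / 2 : ℝ) * ν) * (ENNReal.ofReal (lam ^ 3)⁻¹ * ∫⁻ z in S, G z) := by
        rw [setLIntegral_preimage_zoom G hlam x hS]
    _ = ENNReal.ofReal (a ^ (5 / 2 : ℝ) * (lam ^ 3)⁻¹ * ν) * ∫⁻ z in S, G z := by
        rw [← mul_assoc, ← ENNReal.ofReal_mul (by positivity)]
        congr 2
        ring

/-- The two zoom factors agree at the Navier–Stokes amplitude `a = λ²/ν`:
`a^{5/2} λ⁻³ ν = a^{3/2} λ² λ⁻³` (both equal `λ² ν^{-3/2}`). [folklore] -/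
theorem zoom_factor_eq {ν : ℝ} (hν : 0 < ν) (hlam : 0 < lam) (ha : a = lam ^ 2 / ν) :
    a ^ (5 / 2 : ℝ) * (lam ^ 3)⁻¹ * ν = a ^ (3 / 2 : ℝ) * lam ^ 2 * (lam ^ 3)⁻¹ := by
  have hapos : 0 < a := by rw [ha]; positivity
  have e : a ^ (5 / 2 : ℝ) = a ^ (3 / 2 : ℝ) * a := by
    rw [show (5 / 2 : ℝ) = 3 / 2 + 1 by norm_num, Real.rpow_add hapos, Real.rpow_one]
  rw [e, ha]
  field_simp

/-- **Budget-to-saturation ratios are zoom invariant.** If on a measurable flow set `S` the direction budget is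
at most `δ` times the saturation `∫_S |ω|^{5/2}/ν`, then on the zoomed set `Φ⁻¹ S` (`Φ(y) = x + λ y`,
amplitude `a = λ²/ν`) the budget of `ω̃ = a ω ∘ Φ` is at most `δ` times `∫ |ω̃|^{5/2}`. [folklore] -/
theorem budget_le_sat_zoom {ν δ : ℝ} (hν : 0 < ν) (hlam : 0 < lam) (ha : a = lam ^ 2 / ν)
    (x : EuclideanSpace ℝ (Fin 3)) {S : Set (EuclideanSpace ℝ (Fin 3))} (hS : MeasurableSet S)
    (hle : ∫⁻ z in S, ENNReal.ofReal (‖ω z‖ ^ (3 / 2 : ℝ) * ‖fderiv ℝ (vorticityDirection ω) z‖ ^ 2) ≤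
      ENNReal.ofReal δ * ∫⁻ z in S, ENNReal.ofReal (‖ω z‖ ^ (5 / 2 : ℝ) / ν)) :
    ∫⁻ y in (fun y => x + lam • y) ⁻¹' S,
        ENNReal.ofReal (‖(fun y => a • ω (x + lam • y)) y‖ ^ (3 / 2 : ℝ) *
          ‖fderiv ℝ (vorticityDirection (fun y => a • ω (x + lam • y))) y‖ ^ 2) ≤
      ENNReal.ofReal δ *
        ∫⁻ y in (fun y => x + lam • y) ⁻¹' S,
          ENNReal.ofReal (‖(fun y => a • ω (x + lam • y)) y‖ ^ (5 / 2 : ℝ)) := by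
  have hapos : 0 < a := by rw [ha]; positivity
  rw [setLIntegral_budget_zoom hapos hlam x hS, setLIntegral_sat_zoom hν hapos hlam x hS,
    zoom_factor_eq hν hlam ha]
  calc ENNReal.ofReal (a ^ (3 / 2 : ℝ) * lam ^ 2 * (lam ^ 3)⁻¹) *
        ∫⁻ z in S, ENNReal.ofReal (‖ω z‖ ^ (3 / 2 : ℝ) * ‖fderiv ℝ (vorticityDirection ω) z‖ ^ 2)
      ≤ ENNReal.ofReal (a ^ (3 / 2 : ℝ) * lam ^ 2 * (lam ^ 3)⁻¹) *
          (ENNReal.ofReal δ * ∫⁻ z in S, ENNReal.ofReal (‖ω z‖ ^ (5 / 2 : ℝ) / ν)) :=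
        mul_le_mul_right hle _
    _ = _ := by ring

end Scaling

/-! ### The Type-I zoom at caller-chosen points, read on the vorticity -/

section Zoom

variable {ν T : ℝ} {u : ℝ → EuclideanSpace ℝ (Fin 3) → EuclideanSpace ℝ (Fin 3)}
  {p : ℝ → EuclideanSpace ℝ (Fin 3) → ℝ}

/-- **The Type-I zoom at caller-chosen points (vorticity form).** For `ν > 0`, `T > 0`, a classical solution
`(u, p)` on `ℝ³ × [0, T)`, Leray–Hopf from `u 0`, bounded on every closed sub-strip `[0, T'] × ℝ³`, `T' < T`,
with the Type-I rate at `T`, and ANY base points `(τ_j, x_j)` with `τ_j ∈ [0, T)`, `τ_j → T`: along a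
subsequence `φ` there are `C`, a Type-I ancient mild field `W` (`IsTypeIAncientMild C W`) and scales
`λ_j > 0`, `λ_j² = ν(T − τ_{φ j})`, `λ_j → 0`, such that for every `s < 0` the rescaled vorticities
`y ↦ (λ_j²/ν) ω(T + λ_j² s/ν, x_{φ j} + λ_j y)` converge to `curl W(s)` locally uniformly and their spatial
derivatives converge pointwise to `D(curl W(s))`; the slice `s = −1` reads the solution at the times
`τ_{φ j}` (`T + λ_j²(−1)/ν = τ_{φ j}`). KNSS 2009 §6 rescaling about `(T, x_j)` (zoom kit
`zoom_continuousOn` / `zoom_isWeaklyDivFree` / `zoom_oseen_of_slab` / `zoom_norm_le`) and the tree's `C²_loc`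
compactness on expanding windows `exists_tendsto_of_typeI_oseenMild_windows`; no non-triviality of `W` is
asserted (the caller supplies it, e.g. from a vorticity rate floor at the centres). [cite: KochNadirashviliSereginSverak2009, §6 Lemma 6.1 and proof of Thm 6.2 (arXiv:0709.3599 pp. 11–13)] -/
theorem typeIZoom_vorticity_at_points (hν : 0 < ν) (hT : 0 < T)
    (hsol : IsClassicalNSSolutionOn (Ico 0 T) ν 0 u p) (hLH : IsLerayHopfOn T ν 0 (u 0) u)
    (hslab : ∀ T' < T, ∃ M : ℝ, ∀ t ∈ Icc 0 T', ∀ x, ‖u t x‖ ≤ M)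
    (hI : IsTypeIBlowup u T)
    {τ : ℕ → ℝ} (hτ : ∀ j, τ j ∈ Ico 0 T) (hτT : Tendsto τ atTop (𝓝 T))
    (xc : ℕ → EuclideanSpace ℝ (Fin 3)) :
    ∃ φ : ℕ → ℕ, StrictMono φ ∧
      ∃ (C : ℝ) (W : ℝ → EuclideanSpace ℝ (Fin 3) → EuclideanSpace ℝ (Fin 3)) (lam : ℕ → ℝ),
        IsTypeIAncientMild C W ∧ (∀ j, 0 < lam j) ∧ (∀ j, lam j ^ 2 = ν * (T - τ (φ j))) ∧
        Tendsto lam atTop (𝓝 0) ∧ (∀ j, T + lam j ^ 2 * (-1) / ν = τ (φ j)) ∧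
        (∀ s < (0 : ℝ), TendstoLocallyUniformly
          (fun j y => (lam j ^ 2 / ν) • curl (u (T + lam j ^ 2 * s / ν)) (xc (φ j) + lam j • y))
          (curl (W s)) atTop) ∧
        (∀ s < (0 : ℝ), ∀ y, Tendsto
          (fun j => fderiv ℝ
            (fun y => (lam j ^ 2 / ν) • curl (u (T + lam j ^ 2 * s / ν)) (xc (φ j) + lam j • y)) y)
          atTop (𝓝 (fderiv ℝ (curl (W s)) y))) := by
  -- adapted from the tree's `typeIZoom_ancientMild_limit_flexible` (same construction, free centres)
  have hbdd : ∀ T₁ ∈ Ioo 0 T, ∃ M : ℝ, ∀ t ∈ Icc 0 T₁, ∀ x, ‖u t x‖ ≤ M :=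
    fun T₁ hT₁ => hslab T₁ hT₁.2
  obtain ⟨C₁, hrate⟩ := exists_global_typeI_rate (u := u) hT hbdd hI
  have hC₁ : 0 ≤ C₁ := by
    have h := hrate (T / 2) ⟨by linarith, by linarith⟩ 0
    exact le_trans (mul_nonneg (Real.sqrt_nonneg _) (norm_nonneg _)) h
  -- scales `c_j² T = T - τ_j`
  set R : ℝ := Real.sqrt (ν * T) with hRdef
  have hR : 0 < R := Real.sqrt_pos.2 (mul_pos hν hT)
  have hR2 : R ^ 2 = ν * T := by rw [hRdef, Real.sq_sqrt (mul_pos hν hT).le]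
  set α : ℝ := R / ν with hα
  set β : ℝ := R ^ 2 / ν with hβ
  have hν0 : ν ≠ 0 := hν.ne'
  have hβT : β = T := by rw [hβ, hR2]; field_simp
  have hαpos : 0 < α := by rw [hα]; positivity
  have hTτ : ∀ k, 0 < T - τ k := fun k => sub_pos.2 (hτ k).2
  set c : ℕ → ℝ := fun k => Real.sqrt ((T - τ k) / T) with hcdef
  have hc : ∀ k, 0 < c k := fun k => by rw [hcdef]; exact Real.sqrt_pos.2 (div_pos (hTτ k) hT)
  have hc2 : ∀ k, c k ^ 2 * β = T - τ k := fun k => by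
    rw [hcdef, Real.sq_sqrt (div_pos (hTτ k) hT).le, hβT]; field_simp
  have hTτ0 : Tendsto (fun k => T - τ k) atTop (𝓝[>] 0) := by
    refine tendsto_nhdsWithin_iff.2 ⟨?_, Eventually.of_forall fun k => hTτ k⟩
    have h := hτT.const_sub T
    rwa [sub_self] at h
  have hc0 : Tendsto c atTop (𝓝 0) := by
    have h1 : Tendsto (fun k => (T - τ k) / T) atTop (𝓝 0) := by
      have h := (tendsto_nhdsWithin_iff.1 hTτ0).1.div_const T
      rwa [zero_div] at h
    have h2 := (Real.continuous_sqrt.tendsto 0).comp h1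
    rwa [Real.sqrt_zero] at h2
  -- the windows `(A k, 0)`, `A k = -T/(T - τ_k) → -∞`
  set A : ℕ → ℝ := fun k => -(T / (c k ^ 2 * β)) with hAdef
  have hA : Tendsto A atTop atBot := by
    have h1 : Tendsto (fun k => T / (T - τ k)) atTop atTop := by
      have h := (tendsto_inv_nhdsGT_zero.comp hTτ0).const_mul_atTop hT
      refine h.congr fun k => ?_
      simp only [comp_apply, div_eq_mul_inv]
    refine (tendsto_neg_atTop_atBot.comp h1).congr fun k => ?_
    simp only [hAdef, comp_apply, hc2 k]
  -- the zooms about `(T, x_k)`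
  set w : ℕ → ℝ → EuclideanSpace ℝ (Fin 3) → EuclideanSpace ℝ (Fin 3) :=
    fun k => (c k * α) • stPull (c k ^ 2 * β) (c k * R) T (xc k) u with hwdef
  have hcw : ∀ k, ContinuousOn (uncurry (w k)) (Ioo (A k) 0 ×ˢ univ) := fun k =>
    zoom_continuousOn (x₀ := xc k) hν hsol hR hα hβ (hc k) le_rfl
  have hdivw : ∀ k, ∀ t ∈ Ioo (A k) 0, IsWeaklyDivFree (w k t) := fun k t ht =>
    zoom_isWeaklyDivFree (x₀ := xc k) hν hsol hR hα hβ (hc k) le_rfl ht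
  have hmild : ∀ k, ∀ s t : ℝ, A k < s → s < t → t < 0 → ∀ x,
      w k t x = UnboundedOperators.heatExtension (w k s) (t - s) x -
        oseenDuhamel 1 s (w k) (w k) t x := fun k s t hs hst ht x =>
    zoom_oseen_of_slab (x₀ := xc k) hν hT hsol hLH hbdd hR hα hβ (hc k) le_rfl hs hst ht x
  have hIw : ∀ k, ∀ t ∈ Ioo (A k) 0, ∀ x, ‖w k t x‖ ≤ (α * C₁ / Real.sqrt β) / Real.sqrt (-t) :=
    fun k t ht x => zoom_norm_le (T := T) (x₀ := xc k) (u := u) hR hα hβ hν (hc k) le_rfl hrate ht x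
  have hC : 0 ≤ α * C₁ / Real.sqrt β := by positivity
  -- smoothness of the zoom slices inside the windows
  have hwcl : ∀ k, IsClassicalNSSolutionOn (Ioo (A k) 0) 1 0 (w k)
      ((c k * α) ^ 2 • stPull (c k ^ 2 * β) (c k * R) T (xc k) p) := fun k =>
    zoom_isClassical (x₀ := xc k) hν hsol hR hα hβ (hc k) le_rfl
  have hw2 : ∀ k, ∀ s ∈ Ioo (A k) 0, ContDiff ℝ 2 (w k s) := fun k s hs =>
    contDiff_infty.1 ((hwcl k).contDiff_velocity hs) 2
  -- extraction, second derivatives included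
  obtain ⟨φ, hφ, W, hW, -, hluD, hluH⟩ :=
    exists_tendsto_of_typeI_oseenMild_windows hC hA hcw hdivw hmild hIw
  have hφt : Tendsto φ atTop atTop := hφ.tendsto_atTop
  -- the scales along the subsequence
  set lam : ℕ → ℝ := fun j => c (φ j) * R with hlamdef
  have hlam : ∀ j, 0 < lam j := fun j => mul_pos (hc (φ j)) hR
  have hlam2 : ∀ j, lam j ^ 2 = ν * (T - τ (φ j)) := fun j => by
    rw [hlamdef, mul_pow, ← hc2 (φ j), hβ]
    field_simp
  have hlam0 : Tendsto lam atTop (𝓝 0) := by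
    have h := (hc0.comp hφt).mul_const R
    rw [zero_mul] at h
    exact h
  have hslice : ∀ j, T + lam j ^ 2 * (-1) / ν = τ (φ j) := fun j => by
    rw [hlam2 j]; field_simp; ring
  -- the vorticity zooms are the vorticities of the zooms
  have key : ∀ j (s' : ℝ),
      (fun y => (lam j ^ 2 / ν) • curl (u (T + lam j ^ 2 * s' / ν)) (xc (φ j) + lam j • y)) =
        curl (w (φ j) s') := fun j s' => by
    funext y
    rw [hwdef, curl_smul_stPull]
    have e1 : c (φ j) * α * (c (φ j) * R) = lam j ^ 2 / ν := by
      rw [hlamdef, hα]; field_simp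
    have e2 : T + c (φ j) ^ 2 * β * s' = T + lam j ^ 2 * s' / ν := by
      rw [hlamdef, hβ]; field_simp
    rw [e1, e2]
  have hW2 : ∀ s < (0 : ℝ), ContDiff ℝ 2 (W s) := fun s hs => contDiff_infty.1 (hW.contDiff_slice hs) 2
  refine ⟨φ, hφ, α * C₁ / Real.sqrt β, W, lam, hW, hlam, hlam2, hlam0, hslice, fun s hs => ?_,
    fun s hs y => ?_⟩
  · -- locally uniform convergence of the vorticities (`curl = curlCLM ∘ D`)
    have h := curlCLM.uniformContinuous.comp_tendstoLocallyUniformly (hluD s hs)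
    have e : (fun j y => (lam j ^ 2 / ν) • curl (u (T + lam j ^ 2 * s / ν)) (xc (φ j) + lam j • y)) =
        fun j => ⇑curlCLM ∘ fderiv ℝ (w (φ j) s) := by
      funext j
      rw [key j s]
      rfl
    rw [e, curl_eq_curlCLM_comp]
    exact h
  · -- pointwise convergence of the vorticity gradients (`D curl = curlCLM ∘ D²`, inside the windows)
    have hH : Tendsto (fun j => fderiv ℝ (fderiv ℝ (w (φ j) s)) y) atTop
        (𝓝 (fderiv ℝ (fderiv ℝ (W s)) y)) :=
      (hluH s hs).tendstoLocallyUniformlyOn.tendsto_at (mem_univ y)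
    have hLc : Continuous fun L : EuclideanSpace ℝ (Fin 3) →L[ℝ]
        (EuclideanSpace ℝ (Fin 3) →L[ℝ] EuclideanSpace ℝ (Fin 3)) => curlCLM.comp L :=
      ((ContinuousLinearMap.compL ℝ (EuclideanSpace ℝ (Fin 3))
        (EuclideanSpace ℝ (Fin 3) →L[ℝ] EuclideanSpace ℝ (Fin 3)) (EuclideanSpace ℝ (Fin 3))) curlCLM).continuous
    have hcomp : Tendsto (fun j => curlCLM.comp (fderiv ℝ (fderiv ℝ (w (φ j) s)) y)) atTop
        (𝓝 (curlCLM.comp (fderiv ℝ (fderiv ℝ (W s)) y))) := (hLc.tendsto _).comp hH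
    have hev : ∀ᶠ j in atTop, A (φ j) < s := (hA.comp hφt).eventually (eventually_lt_atBot s)
    rw [fderiv_curl (hW2 s hs) y]
    refine hcomp.congr' ?_
    filter_upwards [hev] with j hj
    rw [key j s, fderiv_curl (hw2 (φ j) s ⟨hj, hs⟩) y]

end Zoom

end Summit.NavierStokesRegularity.NavierStokesRegularity.Theorems

end
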